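import Summits.SmoothPoincare4.SmoothPoincare4.Theses.ConvexBisection
import Summits.SmoothPoincare4.SmoothPoincare4.Theorems.ContractibleTwistedDoubleStandard.Negative.DoubleBisection
import Literature.Topology.FourManifolds.Gluing
import Literature.Topology.FourManifolds.Handles
import Literature.Topology.FourManifolds.BalancedPresentation
import HarnessLib

/-!
# Line `heegaard-morse-thin-multisection` for crux `ConvexBisection.PlanarBisectionRigidity`
(item stmt-SmoothPoincare4-10511, route `route-SmoothPoincare4-ConvexBisection`, rank 5)

Skeleton (crux-plan, planner-cruxplan-stmt-SmoothPoincare4-10511-heegaard-morse-thin--0,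
2026-08-16) of the card `Cruxes/PlanarBisectionRigidity/Ideas/heegaard-morse-thin-multisection.md`
(the HEEGAARD–MORSE SUSPENSION: one argument function `arg ∘ Π` turns the planar Stein bisection of
`Σ` into a THIN `2n`-SECTION of genus `n = k − 1` whose central surface is the doubled page
`K = D(P)` and whose handlebodies `H_{i,j} = (ψ_i ∪ ψ̄′_j)(P × I)` form a grid), RESHAPED by the
three triage notes (TRIAGE-r1-1 pass-with-doubt, r1-2 FAIL, r1-3 pass) and by two sub-lines found
dead while planning (recorded in the line card, "Dead sub-lines"):

* K2 (diagonal Dehn rigidity) is a corollary (r1-1 App. C) / trivial by Hopficity (r1-2 (S3)) —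
  DROPPED; K1 (grid standardness) restates the crux (r1-2) — DROPPED as a statement: the grid is
  only the INDEX SET of the lever below; K3 (window localisation ⇒ `Σ ≅ D(X_F)`) is false in the
  torsion sector (r1-2 (S1)) — DROPPED: no stub of this line outputs a double or compares halves.
* "Contract the thin multisection to an MSZ-extremal `(n; n−1, k₂, k₃)`-trisection and quote
  Meier–Schirmer–Zupan Thm 1.2 (`Literature.Barriers.SmoothPoincare4.msz_homotopySphere_gk`)" is
  what the card's engine amounts to; at the native genus the `k`-deficiencies force the three
  blocks to have `1`, `n−1`, `n` sectors with the `n`-block a 4-BALL, and the only machine-checkable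
  ball certificates (vertical = arc-dual disc systems) force the `n` window curves to be pairwise
  disjoint — impossible for every non-trivial `k = 4` word (types `{m},{0,1},{1,2}`).  DEAD.
* What survives, and is new, is the 3-MANIFOLD HALF of that contraction: the `ℤ²`-family of
  CROSS-SECTIONS `H_v ∪_K H_{v′}` of the grid (`v ≤ v′` comparable vertices) — each an embedded,
  separating, PLANAR (achiral) OPEN BOOK `OB(D_n, μ_{v,v′})`, `μ = (ψ_i⁻¹ψ_{i′})⁻¹(ψ′_j⁻¹ψ′_{j′})`,
  independent of the staircase through `v, v′` — and the observation that a SPHERE among them at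
  `L¹`-distance `n` splits `Σ = X_w ∪_{S³} X_{w′}` into two CONTRACTIBLE 2-HANDLEBODIES
  (`H × I ∪ n` two-handles each; `π₁` trivial by van Kampen in the homotopy sphere), i.e. exhibits
  `Σ ≅ Σ₁ # Σ₂` with `Σ₁, Σ₂` homotopy 4-spheres WITHOUT 3-HANDLES (⇔ without 1-handles) — the
  arena of the route `NoOneHandles` (crux `NoohGscStandard`, item stmt-SmoothPoincare4-0377, rank 2,
  = weak Generalised Property R; `n ≤ 1` two-handles KNOWN by Gabai's Property R).

THE CRUX. For every Hausdorff second-countable `C^∞` 4-manifold `M ≃ₕ S⁴`: if `M = e₁(W₁) ∪ e₂(W₂)`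
for two smoothly embedded compact Stein domains meeting exactly along the images of their boundaries,
with the complex tangencies pushed forward to the same plane field on the seam, and the contact
boundary of `(W₁, J₁)` is PLANAR, then `M ≅ S⁴`.

THE LINE (four stubs; composition `PlanarBisectionRigidity_of`, kernel-checked, no `sorry` of its own).
* `stub_gridDictionary` — DICTIONARY (known modulo vendoring; XL formally).  READ: Wendl
  arXiv:0806.3193 Thm 1 (+ a positive stabilisation of the supporting book so that `k ≥ 2`), Etnyre
  arXiv:math/0404267 Thm 4.1 + Mayer–Vietoris (both factorisations have length `n = k − 1`),
  `M ≃ₕ S⁴` (`⟨x | A, B⟩ = 1`): the bisection is a SPHERE GRID WORD `(n; A, B)` (§2).  WRITE: the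
  Heegaard–Morse suspension (card P1; Islambouli–Naylor arXiv:2010.03057 Prop 3.2 / Cor 3.3,
  Lemma 3.1) + Cerf (longitude freedom = staircases; Hurwitz moves and planar stabilisation re-read the
  same `M`) + the window calculus (§4: `X_w = H_v × I ∪ n` two-handles, `∂X_w = OB(D_n, μ_{v,v′})`,
  `π₁(OB) = ⟨x | uᵢ(μ)⟩`) + Poincaré–Perelman give: a reachable SPHERE WINDOW splits `M` along a
  simply connected seam into two contractible compact pieces with handle counts `(1, n, n, 0, 0)`
  (`SphereSplit M n`, §5).
* `stub_sphereWindow` — THE LEVER (new; the line's bet; HARDEST): every sphere grid word reaches,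
  by Hurwitz moves on each side and planar stabilisations, a word with a SPHERE WINDOW — comparable
  vertices `v ≤ v′` at `L¹`-distance `n` whose cross-section presentation `⟨x | uᵢ(μ_{v,v′})⟩`
  presents the trivial group — OR an HONEST DOUBLE `A′ = B′` (a target with zero moves for every
  double `(A, A)`, so that the Andrews–Curtis-strength corner shared by every line on this crux costs
  the lever nothing, exactly as in line seam-walk's REACH).  Pure combinatorics of the framed braid
  group; decidable instance by instance (coset enumeration); NOT implied by SPC4 (a sphere grid word
  inside `S⁴` whose whole orbit has neither a sphere window nor a double refutes it without an exotic
  sphere); distinct from seam-walk's REACH (its states are block RE-READINGS `A′·B̄′ʳᵉᵛ`, tubes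
  avoiding the central surface; windows are wedges CONTAINING it, mix letters of both halves, and
  never conjugate an `A`-curve by a `B`-twist) — the toy run of the line card shows the lever firing
  (three certified sphere windows, one hand-checked) on Disproof §7's smallest UNDECIDED twin.
* `stub_sphereSplitStandard` — THE CAP (residual; SPC4-implied; open = weak GPRC-strength): a
  homotopy 4-sphere bisected along a simply connected seam into two contractible compact pieces with
  handle decompositions without 3- and 4-handles is `S⁴`.  On paper ⟸ item stmt-SmoothPoincare4-0377
  `NoohGscStandard` (cap each piece with a 4-handle: a homotopy sphere without 3-handles; turn it
  upside down; Palais' disc theorem; Cerf `Γ₄ = 0`) — DELEGATE; `n ≤ 1` is Gabai's Property R.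
* `stub_planarSteinDouble` — THE DOUBLES CORNER (residual; open; Andrews–Curtis strength; the
  SAME statement as line seam-walk's `stub_planarSteinDouble`, filed once per TRIAGE-r1-2): the
  double of a contractible compact Stein domain with planar contact boundary is `S⁴`; PROVED in §6
  from the route's crux `ContractibleTwistedDoubleStandard` (stmt-SmoothPoincare4-3546) via the
  landed `double_standard_of_crux` — DELEGATE (also ⟸ item 3717 `PresentationSpheresStandard` on
  paper).
* `PlanarBisectionRigidity_of : ConvexBisection.PlanarBisectionRigidity` — dictionary ⇒ word,
  lever ⇒ sphere window or double, dictionary ⇒ split resp. double, cap resp. doubles corner.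
  Pure logic.

DISPROOF USED (`Cruxes/PlanarBisectionRigidity/Disproof.lean`, gen 3 v7.2, sorry-free; no
`_false_without_` theorem by that name exists for this crux — its §3 load-bearing analysis plays the
role): `withoutPlanar_iff_smoothPoincare4` (planarity is THE load-bearing restriction) — used at
`stub_gridDictionary` (Wendl's theorem needs a planar seam; thinness of every sector = planar
arc-duality) and at `stub_sphereWindow` (the whole calculus is genus 0: curves are braid images of
round curves, cross-sections are planar open books); `withoutHomotopyEquiv_false_of` (`S¹ × S³`) —
`M ≃ₕ S⁴` is used at the dictionary (`⟨x | A, B⟩ = 1`, lengths `n`, `χ = 2 ⇒ 2n` sectors; van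
Kampen along the window) and at the cap; §6 `seamIsSphere_false_of` (HalvesAreBalls false:
Akbulut-cork double) — no stub asserts a half is a ball: spheres are sought among MIXED windows;
§7 (`k = 4` layer = reflection twins; `twin_identity`) — the smallest twin and its double are the
lever's first instances (line card, "Toy run"); §8 / `Negative/SeamExtension.lean` — no stub outputs
`IsDouble` or a diffeomorphism of the halves (Hayden-safe).  `ledger negatives --problem
SmoothPoincare4`: none of this line's statements is a refuted one.
-/

noncomputable section

open scoped Manifold ContDiff Topology ContinuousMap
open Set Function
open Literature.Geometry.Symplectic Literature.Topology.FourManifolds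

-- `BoundaryData`, `IsDouble` (Gluing.lean), `HasHandleDecomposition` (Handles.lean) are used unqualified.

-- The namespace is prescribed by the crux protocol (`Summit.<P>.<Sub>.Cruxes.<Crux>.<Slug>` with
-- `P = Sub = SmoothPoincare4`), hence the duplicated component.
set_option linter.dupNamespace false
set_option linter.unusedVariables false

namespace Summit.SmoothPoincare4.SmoothPoincare4.Cruxes.PlanarBisectionRigidity.HeegaardMorseThinMultisection

open Summit.SmoothPoincare4.SmoothPoincare4.Theses

/-- Local notation: the round 4-sphere with its Mathlib manifold structure. -/
local notation "𝕊⁴" => (Metric.sphere (0 : EuclideanSpace ℝ (Fin 5)) 1)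

/-- Local notation: the model space `ℝ⁴`. -/
local notation "E4" => EuclideanSpace ℝ (Fin 4)

/-! ## §1  The planar word calculus (verbatim copy of line seam-walk-one-sided-ball §1)

Shared substrate (TRIAGE-r1-1 "merge" remark): the page is the disc `D_n` with `n = k − 1` holes
`0, …, n−1`, outer boundary `∂₀`, base point `p₀ ∈ ∂₀`, arcs `δᵢ` from `p₀` to hole `i`, free
generators `xᵢ` of `π₁(D_n, p₀) = F_n`.  A mapping class is recorded FAITHFULLY by its ARC DATA
`(π, u)`, `φ(δᵢ) ≃ uᵢ · δ_{π i}`; the seam / cross-section group of the planar open book `OB(D_n, φ)`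
is the balanced presentation `⟨x₀ … x_{n−1} ∣ u₀(φ), …, u_{n−1}(φ)⟩` (validated by the cdisprove
census and TRIAGE-r1-2 (S1) against lens spaces, Seifert spaces, the lantern relation).  The
definitions below are copied unchanged so that the lead's toolkit (`work/engine/arcdata.py`) and the
census scripts apply to this line's windows without translation. -/

/-- ARC DATA of a (hole-permuting, non-rotating, `∂₀`-fixing) mapping class of the disc with `n` holes:
the permutation `π` of the holes and the words `uᵢ = [φ(δᵢ) · δ_{π i}⁻¹] ∈ F_n`. [folklore] -/
structure ArcData (n : ℕ) where
  /-- the permutation of the holes -/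
  perm : Equiv.Perm (Fin n)
  /-- the arc words `uᵢ` -/
  u : Fin n → FreeGroup (Fin n)

namespace ArcData

variable {n : ℕ}

/-- The induced automorphism of `F_n = π₁(D_n, p₀)`: `xᵢ ↦ uᵢ · x_{π i} · uᵢ⁻¹`. [folklore] -/
def aut (φ : ArcData n) : FreeGroup (Fin n) →* FreeGroup (Fin n) :=
  FreeGroup.lift fun i => φ.u i * FreeGroup.of (φ.perm i) * (φ.u i)⁻¹

/-- The identity mapping class. [folklore] -/
def one : ArcData n := ⟨1, fun _ => 1⟩

/-- Composition `φ ∘ ψ` (`ψ` first): `π = π_φ π_ψ`, `uᵢ = φ_*(u^ψᵢ) · u^φ_{π_ψ i}`. [folklore] -/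
def mul (φ ψ : ArcData n) : ArcData n :=
  ⟨φ.perm * ψ.perm, fun i => φ.aut (ψ.u i) * φ.u (ψ.perm i)⟩

end ArcData

/-- GENERATORS of the framed braid group of the holed disc, as hole-index syntax independent of `n`:
`sigma j inv` = the half-twist `σⱼ^{±1}` exchanging holes `j`, `j+1`; `round a b inv` = the Dehn twist
`T_[a,b]^{±1}` about the round curve enclosing the consecutive holes `a, …, b`. [folklore] -/
inductive PGen where
  | sigma (j : ℕ) (inv : Bool)
  | round (a b : ℕ) (inv : Bool)
  deriving DecidableEq

namespace PGen

/-- Formal inverse of a generator. [folklore] -/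
def inv : PGen → PGen
  | sigma j s => sigma j (!s)
  | round a b s => round a b (!s)

/-- `g.below n`: the generator does not involve the hole `n` (nor any hole beyond it). [folklore] -/
def below (n : ℕ) : PGen → Bool
  | sigma j _ => decide (j + 1 < n)
  | round _ b _ => decide (b < n)

/-- The word `x_a x_{a+1} ⋯ x_b ∈ F_n` of the round curve around the holes `a … b` (holes `≥ n` are
ignored). [folklore] -/
def blockWord (n a b : ℕ) : FreeGroup (Fin n) :=
  (((List.finRange n).filter fun i => decide (a ≤ i.val ∧ i.val ≤ b)).map FreeGroup.of).prod

/-- Arc data of a generator on the disc with `n` holes.  `σⱼ`: `π = (j j+1)`, `uⱼ = xⱼ`, else `1`;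
`σⱼ⁻¹`: `π = (j j+1)`, `uⱼ₊₁ = xⱼ₊₁⁻¹`, else `1`; `T_[a,b]^{±1}`: `π = 1`, `uᵢ = (x_a ⋯ x_b)^{±1}` for
`a ≤ i ≤ b`, else `1`.  A half-twist with `j + 1 ≥ n` is the identity. [folklore] -/
def data (n : ℕ) : PGen → ArcData n
  | sigma j s =>
      if h : j + 1 < n then
        { perm := Equiv.swap (⟨j, by omega⟩ : Fin n) ⟨j + 1, h⟩
          u := fun i =>
            if s then (if i = ⟨j + 1, h⟩ then (FreeGroup.of (⟨j + 1, h⟩ : Fin n))⁻¹ else 1)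
            else (if i = ⟨j, by omega⟩ then FreeGroup.of (⟨j, by omega⟩ : Fin n) else 1) }
      else ArcData.one
  | round a b s =>
      { perm := 1
        u := fun i => if a ≤ i.val ∧ i.val ≤ b then
          (if s then (blockWord n a b)⁻¹ else blockWord n a b) else 1 }

end PGen

/-- Arc data of a word of generators (`foldr`: the LAST letter acts first, `eval [g₁, g₂] = g₁ ∘ g₂`).
[folklore] -/
def evalWord (n : ℕ) (g : List PGen) : ArcData n :=
  g.foldr (fun x acc => ArcData.mul (PGen.data n x) acc) ArcData.one

/-- Formal inverse of a word. [folklore] -/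
def invWord (g : List PGen) : List PGen :=
  (g.map PGen.inv).reverse

/-- A simple closed curve on the holed disc, presented as the image `g(c_[a,b])` of the round curve
around the holes `a … b` under the word `g` (every essential simple closed curve is of this form).
[folklore] -/
structure PlanarCurve where
  /-- first hole of the round block -/
  a : ℕ
  /-- last hole of the round block -/
  b : ℕ
  /-- the carrying word -/
  g : List PGen

namespace PlanarCurve

/-- The Dehn twist about `g(c_[a,b])`, positive (`pos = true`) or negative, as the word
`g · T_[a,b]^{±1} · g⁻¹`. [folklore] -/
def twistWord (c : PlanarCurve) (pos : Bool) : List PGen :=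
  c.g ++ [PGen.round c.a c.b (!pos)] ++ invWord c.g

/-- The class `[c] = g_*(x_a ⋯ x_b) ∈ F_n` of the curve (well defined up to conjugacy). [folklore] -/
def cls (n : ℕ) (c : PlanarCurve) : FreeGroup (Fin n) :=
  (evalWord n c.g).aut (PGen.blockWord n c.a c.b)

/-- The image curve `h(c)`. [folklore] -/
def image (h : List PGen) (c : PlanarCurve) : PlanarCurve :=
  ⟨c.a, c.b, h ++ c.g⟩

/-- `c.InRange n`: the syntax of `c` only mentions the holes `0, …, n−1` and its round block is
nonempty (hence the curve is homologically essential on `D_n`: it encloses at least one hole), so that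
`c` denotes the SAME curve on the disc with `n + 1` holes. [folklore] -/
def InRange (n : ℕ) (c : PlanarCurve) : Prop :=
  c.a ≤ c.b ∧ c.b < n ∧ ∀ x ∈ c.g, PGen.below n x = true

end PlanarCurve

/-! ## §2  Sphere grid words

CONVENTION (one, used throughout): a positive factorisation is a list `A = [a₁, …, a_n]` of curves whose
FIRST entry acts first; its FRAME after `i` letters is `ψ_i := T_{a_i} ∘ ⋯ ∘ T_{a₁}` and its monodromy
is `φ = ψ_n`.  (Line seam-walk's `monodromy` composes in the opposite order; the two classes of words
correspond under list reversal.  Handedness of `T_[a,b]` is likewise immaterial: the dictionary below is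
existential in the encoding, and a reflection of the page transports one convention to the other.)
In the grid of the card, the handlebody at vertex `(i, j)` is `H_{i,j} = (ψ_i ∪ ψ̄′_j)(P × I)`;
crossing the `A`-sector `a_{i+1}` replaces `H_{i,j}` by `t_{a_{i+1}}(H_{i,j})`, the `B`-sector
`b̄_{j+1} ⊂ P̄` replaces it by `t̄_{b_{j+1}}(H_{i,j})`; `H_{i+n, j+n} = H_{i,j}` and
`ψ_{n+i} = ψ_i ∘ φ` (the `A`-curves repeat cyclically in the fixed frame of the central surface). -/

/-- Word of the FRAME `ψ_i = T_{a_i} ∘ ⋯ ∘ T_{a₁}` of the first `i` curves of `F` (positive twists; in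
`evalWord`'s right-to-left convention the first curve's twist is written last). [folklore] -/
def frameWord (F : List PlanarCurve) (i : ℕ) : List PGen :=
  (F.take i).reverse.flatMap fun c => c.twistWord true

/-- Frame word for indices up to `2 · |F|` (one wrap around the grid): `ψ_{|F| + i} = ψ_i ∘ φ`.
[folklore] -/
def frameWordZ (F : List PlanarCurve) (i : ℕ) : List PGen :=
  if i ≤ F.length then frameWord F i else frameWord F (i - F.length) ++ frameWord F F.length

/-- The curves `C` normally generate `F_n` (`π₁` of the closed 4-manifold `X_A ∪ X̄_B` is
`F_n / ⟨⟨[aⱼ], [bⱼ]⟩⟩` by van Kampen through the page group). [folklore] -/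
def NormallyGenerates (n : ℕ) (C : List PlanarCurve) : Prop :=
  Subgroup.normalClosure {x | x ∈ C.map (PlanarCurve.cls n)} = ⊤

/-- SPHERE GRID WORD: two positive factorisations `A`, `B` (in-range syntax) of ONE mapping class of the
disc with `n ≥ 1` holes (equal frame after all `n` letters, i.e. equal arc data of the monodromy), each
of length `n` (⇔ both halves rationally acyclic — Etnyre), whose curves jointly normally generate `F_n`
(⇔ the closed 4-manifold `Σ(A, B) = X_A ∪ X̄_B` is a homotopy 4-sphere: `χ = 2`, `π₁ = 1`).  NO
unimodularity: the integral and the torsion sector (TRIAGE-r1-2 (S1)) are treated alike by this line.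
Every such word IS geometric: `Σ(A, B)` is a smooth homotopy 4-sphere with a planar common-contact
Stein bisection (TRIAGE-r1-2 (S1)). [folklore] -/
structure IsSphereGridWord (n : ℕ) (A B : List PlanarCurve) : Prop where
  pos : 0 < n
  inRange : ∀ c ∈ A ++ B, c.InRange n
  length_left : A.length = n
  length_right : B.length = n
  monodromy_eq : evalWord n (frameWord A n) = evalWord n (frameWord B n)
  sphere : NormallyGenerates n (A ++ B)

/-! ## §3  Moves re-reading the same 4-manifold: Hurwitz moves on each side, planar stabilisation -/

/-- Elementary HURWITZ MOVES on a positive factorisation (first entry acts first): the pair `(x, y)`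
contributes `T_y ∘ T_x`, and `T_y ∘ T_x = T_x ∘ T_{T_x⁻¹(y)} = T_{T_y(x)} ∘ T_y`; so
`(x, y) ↦ (T_x⁻¹(y), x)` (`fwd`) and `(x, y) ↦ (y, T_y(x))` (`bwd`) preserve every frame past the pair.
Geometrically: the critical values of ONE half braid past each other — an isotopy of that Lefschetz
fibration, hence of the bisection. (Gompf–Stipsicz §8.2.) -/
inductive HMove : List PlanarCurve → List PlanarCurve → Prop
  | fwd (pre post : List PlanarCurve) (x y : PlanarCurve) :
      HMove (pre ++ x :: y :: post)
        (pre ++ PlanarCurve.image (x.twistWord false) y :: x :: post)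
  | bwd (pre post : List PlanarCurve) (x y : PlanarCurve) :
      HMove (pre ++ x :: y :: post)
        (pre ++ y :: PlanarCurve.image (y.twistWord true) x :: post)

/-- GRID MOVES on states `(n; A, B)`: a Hurwitz move on the `A` side, a Hurwitz move on the `B` side, or a
PLANAR STABILISATION — a new hole `n` and the same new LAST letter `γ = g(c_[m,n])` (`m ≤ n`, `g` supported
off the new hole: a curve meeting the co-core of the new 1-handle once) appended to BOTH factorisations
(positive Giroux stabilisation of the common seam book, both fillings stabilised; offered only from
in-range states).  Each move re-reads the SAME closed 4-manifold with a new planar common-contact Stein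
bisection / a new grid. (Baykur arXiv:math/0601396 Thm 5.1; Wendl arXiv:0806.3193 Thm 1.) -/
inductive GMove : ℕ × List PlanarCurve × List PlanarCurve → ℕ × List PlanarCurve × List PlanarCurve → Prop
  | left (n : ℕ) (A A' B : List PlanarCurve) (h : HMove A A') : GMove (n, A, B) (n, A', B)
  | right (n : ℕ) (A B B' : List PlanarCurve) (h : HMove B B') : GMove (n, A, B) (n, A, B')
  | stabilize (n m : ℕ) (g : List PGen) (A B : List PlanarCurve) (hm : m ≤ n)
      (hg : ∀ x ∈ g, PGen.below n x = true) (hAB : ∀ c ∈ A ++ B, c.InRange n) :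
      GMove (n, A, B) (n + 1, A ++ [⟨m, n, g⟩], B ++ [⟨m, n, g⟩])

/-- The orbit of the grid moves (reflexive–transitive closure). [folklore] -/
def GridReachable : ℕ × List PlanarCurve × List PlanarCurve → ℕ × List PlanarCurve × List PlanarCurve → Prop :=
  Relation.ReflTransGen GMove

/-! ## §4  Windows of the grid and their cross-sections

A WINDOW is a pair of comparable grid vertices `v = (i, j) ≤ v′ = (i′, j′)` (start normalised to
`0 ≤ i, j ≤ n`, at most one wrap: `i′ ≤ i + n`, `j′ ≤ j + n`) at `L¹`-distance `n`:
`(i′ − i) + (j′ − j) = n`.  The two handlebodies `H_v`, `H_{v′}` are simultaneously levels of the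
suspension for every staircase through `v, v′`, so `H_v ∪_K H_{v′}` is an embedded separating closed
3-manifold — the CROSS-SECTION — cutting `Σ` into `X_w` (the `n` sectors from `v` to `v′`) and `X_{w′}`
(the `n` sectors from `v′` to `v + (n,n)`); both are INDEPENDENT OF THE STAIRCASE.  Pulling back by
`(ψ_i ∪ ψ̄′_j)`: `H_v ∪_K H_{v′} ≅ (P × I) ∪_K (f ∪ ḡ)(P × I) = OB(D_n, f⁻¹g)` (up to orientation),
`f = ψ_i⁻¹ψ_{i′}` = the product of the positive twists along the PULLED-BACK `A`-run
`ψ_i⁻¹(a_{i+1}), …, ψ_i⁻¹(a_{i′})`, `g = ψ′_j⁻¹ψ′_{j′}` likewise for the `B`-run; and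
`X_w ≅ H_v × I ∪ {2-handles along the a-run ⊂ P and the b̄-run ⊂ P̄}` = the ACHIRAL planar Lefschetz
fibration over the wedge with factorisation (pulled-back `A`-run, positive)·(pulled-back `B`-run,
negative): a 2-HANDLEBODY with `n` one-handles and `n` two-handles.  The cross-section group is the
arc-data presentation `⟨x | uᵢ(g ∘ f⁻¹)⟩`. -/

/-- Word of the `A`-part `f = ψ_i⁻¹ ∘ ψ_{i′}` of a window. [folklore] -/
def aPartWord (A : List PlanarCurve) (i i' : ℕ) : List PGen :=
  invWord (frameWordZ A i) ++ frameWordZ A i'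

/-- Word of the `B`-part `g = ψ′_j⁻¹ ∘ ψ′_{j′}` of a window. [folklore] -/
def bPartWord (B : List PlanarCurve) (j j' : ℕ) : List PGen :=
  invWord (frameWordZ B j) ++ frameWordZ B j'

/-- Word of the CROSS-SECTION MONODROMY `μ_{v,v′} = g ∘ f⁻¹` (conjugate to `f⁻¹ ∘ g`; the 3-manifold
`OB(D_n, μ)` does not see conjugation or inversion). [folklore] -/
def crossSectionWord (A B : List PlanarCurve) (i j i' j' : ℕ) : List PGen :=
  bPartWord B j j' ++ invWord (aPartWord A i i')

/-- The CROSS-SECTION PRESENTATION `⟨x₀ … x_{n−1} ∣ uᵢ(μ_{v,v′})⟩` of `π₁(H_v ∪_K H_{v′})` — the arc data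
of the cross-section monodromy (mapping torus relations become trivial once the outer binding meridian
`t = 1` is imposed; the remaining relators are the inner binding meridians `uᵢ`). [folklore] -/
def crossSection (n : ℕ) (A B : List PlanarCurve) (i j i' j' : ℕ) : BalancedPresentation n :=
  (evalWord n (crossSectionWord A B i j i' j')).u

/-- `IsWindow n i j i′ j′`: `(i, j) ≤ (i′, j′)` comparable grid vertices, start in `[0, n]²`, at most one
wrap, at `L¹`-distance exactly `n` (so that the window `X_w` and its complement `X_{w′}` consist of `n`
sectors each — the only size at which a sphere cross-section can occur, `χ(X_w ∪ B⁴) = 2`). [folklore] -/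
structure IsWindow (n i j i' j' : ℕ) : Prop where
  start_left : i ≤ n
  start_right : j ≤ n
  mono_left : i ≤ i'
  mono_right : j ≤ j'
  wrap_left : i' ≤ i + n
  wrap_right : j' ≤ j + n
  length : i' + j' = i + j + n

/-- SPHERE WINDOW: a window whose cross-section presentation presents the TRIVIAL GROUP — so the
cross-section `H_v ∪_K H_{v′}`, a closed connected 3-manifold, is simply connected, hence `S³`
(Perelman), and `Σ = X_w ∪_{S³} X_{w′}`.  Decidable-in-practice instance by instance (coset
enumeration on a balanced `n`-generator presentation). [folklore] -/
def SphereWindow (n : ℕ) (A B : List PlanarCurve) (i j i' j' : ℕ) : Prop :=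
  IsWindow n i j i' j' ∧ (crossSection n A B i j i' j').PresentsTrivialGroup

/-! ## §5  The split, and the three stubs -/

/-- Handle counts of a CONTRACTIBLE 2-HANDLEBODY piece: one 0-handle, `n` 1-handles, `n` 2-handles,
nothing of index `≥ 3` (argument for `Literature.Topology.FourManifolds.HasHandleDecomposition 3`).
[folklore] -/
def pieceHandleCount (n : ℕ) : ℕ → ℕ :=
  fun k => if k = 0 then 1 else if k = 1 then n else if k = 2 then n else 0

/-- `SphereSplit M n`: `M` is covered by two smoothly embedded compact CONTRACTIBLE 4-manifolds with
boundary `U₁`, `U₂`, meeting exactly along the images of their boundaries in a SIMPLY CONNECTED seam,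
each admitting a handle decomposition with one 0-handle, `n` 1-handles, `n` 2-handles and no 3- or
4-handles (`HasHandleDecomposition 3 Uᵢ (pieceHandleCount n)`: a boundary-adapted Morse function with
these critical counts).  This is the output of a sphere window: `U₁ = X_w`, `U₂ = X_{w′}`,
seam `= H_v ∪_K H_{v′} ≅ S³`. [folklore] -/
def SphereSplit (M : Type) [TopologicalSpace M] [ChartedSpace E4 M] (n : ℕ) : Prop :=
  ∃ (U₁ : Type) (_ : TopologicalSpace U₁) (_ : ChartedSpace (EuclideanHalfSpace 4) U₁)
    (_ : IsManifold (𝓡∂ 4) ∞ U₁) (_ : CompactSpace U₁) (_ : ContractibleSpace U₁)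
    (U₂ : Type) (_ : TopologicalSpace U₂) (_ : ChartedSpace (EuclideanHalfSpace 4) U₂)
    (_ : IsManifold (𝓡∂ 4) ∞ U₂) (_ : CompactSpace U₂) (_ : ContractibleSpace U₂)
    (f₁ : U₁ → M) (f₂ : U₂ → M),
    HasHandleDecomposition 3 U₁ (pieceHandleCount n) ∧
    HasHandleDecomposition 3 U₂ (pieceHandleCount n) ∧
    Manifold.IsSmoothEmbedding (𝓡∂ 4) (𝓡 4) ∞ f₁ ∧ Manifold.IsSmoothEmbedding (𝓡∂ 4) (𝓡 4) ∞ f₂ ∧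
    range f₁ ∪ range f₂ = univ ∧
    range f₁ ∩ range f₂ = f₁ '' (𝓡∂ 4).boundary U₁ ∧
    range f₁ ∩ range f₂ = f₂ '' (𝓡∂ 4).boundary U₂ ∧
    SimplyConnectedSpace ↥(range f₁ ∩ range f₂)

/-- **Stub 1 — THE GRID DICTIONARY (known modulo vendoring; size XL formally).**  Under the hypotheses of
the crux, unbundled: there is a sphere grid word `(n; A, B)` (READ: choose a planar open book supporting
`(∂W₁, ξ₁)`, positively stabilised once if needed so that `k ≥ 2`; Wendl arXiv:0806.3193 Thm 1 makes
BOTH halves planar Lefschetz fibrations over it — planarity crosses the seam by the landed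
`stub_planarSeamTransfer`, p76418 — so `W₁ ≅ X_A`, `W₂ ≅ X_B` for positive factorisations of one
monodromy; Etnyre arXiv:math/0404267 Thm 4.1 + Mayer–Vietoris in the homology sphere `M` force length
`n = k − 1` on both sides; `M ≃ₕ S⁴` gives `⟨x | A, B⟩ = 1`; `B` is read in the crossing order of the
suspension, so that its prefix frames are the grid frames) such that every state GRID-REACHABLE from it
(Hurwitz moves = isotopies of one fibration; planar stabilisation = Giroux stabilisation of both
fillings: the same `M`, a new planar bisection, a new grid) and every SPHERE WINDOW of that state
yield a `SphereSplit` of `M` (WRITE: the Heegaard–Morse suspension — `K = Π₁⁻¹(0) ∪_B Π₂⁻¹(0) = D(P)`,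
`α = arg ∘ Π` circle-valued Morse with the `2n` Lefschetz points as index-2 critical points, levels
`H_θ ≅ P × [0,2]`, sectors `H × I ∪ (one 2-handle)`, Islambouli–Naylor arXiv:2010.03057 Prop 3.2 /
Cor 3.3 / Lemma 3.1; longitudes of the `A`- and `B`-critical values are independent (Cerf), so every
comparable pair of grid vertices bounds an embedded window `X_w = H_v × I ∪ n` two-handles, a compact
contractible-iff-`π₁ = 1` 2-handlebody with a boundary-adapted Morse function of counts `(1, n, n, 0, 0)`,
and `∂X_w = H_v ∪_K H_{v′} = OB(D_n, μ_{v,v′})` with `π₁ = ⟨x | uᵢ(μ)⟩`; if that group is trivial the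
seam is simply connected, `π₁(M) = 1 = π₁(X_w) ∗ π₁(X_{w′})` makes both pieces contractible); and
(ii) every grid-reachable HONEST DOUBLE `(n′; A′, A′)` exhibits `M` as the double `D(X_{A′})` of a
contractible (`⟨⟨A′⟩⟩ = ⟨⟨A′, A′⟩⟩ = F`, `χ = 1`) compact Stein domain with planar contact boundary
(verbatim the second clause of seam-walk's `stub_wendlDictionary`).  Why plausibly true: it is the standard Lefschetz-fibration / open-book / multisection dictionary; the only
delicate points (the zipped sides of `H_θ`, path-independence of `X_w`, the order in which `B` is
crossed) are checked in the line card.  SPC4-implied (its conclusion holds for `S⁴`).  Uses `M ≃ₕ S⁴`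
and planarity (Disproof §3: both load-bearing).  [cite: arXiv:0806.3193, Thm 1]
[cite: arXiv:2010.03057, Prop 3.2] -/
theorem stub_gridDictionary
    (M : Type) [TopologicalSpace M] [T2Space M] [SecondCountableTopology M] [ChartedSpace E4 M]
    [IsManifold (𝓡 4) ∞ M] (hM : M ≃ₕ 𝕊⁴)
    (W₁ : Type) [TopologicalSpace W₁] [ChartedSpace (EuclideanHalfSpace 4) W₁] [IsManifold (𝓡∂ 4) ∞ W₁]
    [CompactSpace W₁] (W₂ : Type) [TopologicalSpace W₂] [ChartedSpace (EuclideanHalfSpace 4) W₂]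
    [IsManifold (𝓡∂ 4) ∞ W₂] [CompactSpace W₂] (J₁ : SteinStructure W₁) (J₂ : SteinStructure W₂)
    (e₁ : W₁ → M) (e₂ : W₂ → M)
    (he₁ : Manifold.IsSmoothEmbedding (𝓡∂ 4) (𝓡 4) ∞ e₁)
    (he₂ : Manifold.IsSmoothEmbedding (𝓡∂ 4) (𝓡 4) ∞ e₂)
    (hcover : range e₁ ∪ range e₂ = univ)
    (hseam₁ : range e₁ ∩ range e₂ = e₁ '' (𝓡∂ 4).boundary W₁)
    (hseam₂ : range e₁ ∩ range e₂ = e₂ '' (𝓡∂ 4).boundary W₂)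
    (hξ : ∀ w₁ w₂, e₁ w₁ = e₂ w₂ →
      Submodule.map (mfderiv (𝓡∂ 4) (𝓡 4) e₁ w₁).toLinearMap (contactPlane J₁.J w₁) =
      Submodule.map (mfderiv (𝓡∂ 4) (𝓡 4) e₂ w₂).toLinearMap (contactPlane J₂.J w₂))
    (hplanar : PlanarContactBoundary J₁) :
    ∃ (n : ℕ) (A B : List PlanarCurve), IsSphereGridWord n A B ∧
      (∀ (n' : ℕ) (A' B' : List PlanarCurve) (i j i' j' : ℕ),
        GridReachable (n, A, B) (n', A', B') → SphereWindow n' A' B' i j i' j' → SphereSplit M n') ∧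
      (∀ (n' : ℕ) (A' : List PlanarCurve), GridReachable (n, A, B) (n', A', A') →
        ∃ (W : Type) (_ : TopologicalSpace W) (_ : T2Space W) (_ : SecondCountableTopology W)
          (_ : ChartedSpace (EuclideanHalfSpace 4) W) (_ : IsManifold (𝓡∂ 4) ∞ W) (_ : CompactSpace W)
          (_ : ContractibleSpace W) (J : SteinStructure W) (b : BoundaryData (𝓡∂ 4) W (𝓡 3)),
          PlanarContactBoundary J ∧ IsDouble b (𝓡 4) M) := by
  sorry

/-- **Stub 2 — THE LEVER: SPHERE WINDOWS EXIST (new; the line's bet; HARDEST).**  Pure combinatorics of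
the framed braid group: every sphere grid word `(n; A, B)` reaches, by Hurwitz moves on each side and
planar stabilisations, a state `(n′; A′, B′)` with a SPHERE WINDOW — comparable grid vertices
`(i, j) ≤ (i′, j′)` at `L¹`-distance `n′` whose cross-section presentation
`⟨x ∣ uᵢ((ψ′_j⁻¹ψ′_{j′}) ∘ (ψ_i⁻¹ψ_{i′})⁻¹)⟩` presents the trivial group — OR an HONEST DOUBLE
`A′ = B′` (zero moves for `(A, A)`; the doubles corner is Stub 4).  Why plausibly true: the
target set is large (`(n′+1)²` starts × `n′+1` splits per state, both sectors of `H₁` allowed), it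
asks only for ONE separating 3-sphere among the planar achiral open books the grid embeds in `Σ` — not
for a ball, a double, or a comparison of the halves — and every instance is decidable (coset
enumeration; necessary filter `H₁ = coker = 0` from the hole-set matrices of the two runs); true with
zero moves for `n ≤ 2` (abelian `Mod`) and for the trivial bisection of `S⁴` at every `n` (window
`(0,0) ≤ (n−1, 1)`-type chains).  NOT implied by SPC4: a sphere grid word realised inside `S⁴` all of
whose reachable windows are aspherical kills it without an exotic sphere — first benchmark = Disproof
§7's smallest `k = 4` reflection twin `(d, r₁₂, β(r₂₃)) / (d, T₂₃⁻¹(r₁₂), T₁₂⁻¹(r₂₃))` and its honest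
double (line card "Toy run"), then the 8 + 64 certified census pairs and TRIAGE-r1-2 (S1)'s 19 torsion
words.  Size XL (a theorem about `B_n ⋉ ℤⁿ`; instances by explicit windows).  Planarity is used
essentially (genus-0 pages: the cross-sections are planar open books and the state space exists).
(Wendl arXiv:0806.3193 Thm 1; Islambouli–Naylor arXiv:2010.03057 §4.) -/
theorem stub_sphereWindow (n : ℕ) (A B : List PlanarCurve) (h : IsSphereGridWord n A B) :
    ∃ (n' : ℕ) (A' B' : List PlanarCurve), GridReachable (n, A, B) (n', A', B') ∧
      ((∃ i j i' j' : ℕ, SphereWindow n' A' B' i j i' j') ∨ A' = B') := by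
  sorry

/-- **Stub 3 — THE CAP: a homotopy 4-sphere split along a simply connected seam into two contractible
2-handlebodies is `S⁴` (residual; open; weak-GPRC strength; SPC4-implied).**  Data: `M ≃ₕ S⁴` and
`SphereSplit M n`.  Then the seam, a closed connected simply connected 3-manifold, is `S³` (Perelman);
capping `U₁` with a 4-handle gives a homotopy 4-sphere `Σ₁ = U₁ ∪ B⁴` with a handle decomposition
WITHOUT 3-HANDLES, i.e. (upside down, `f ↦ −f`) a Morse function WITHOUT INDEX-1 critical points, so
`Σ₁ ≅ S⁴` by item stmt-SmoothPoincare4-0377 `NoohGscStandard` (route NoOneHandles, crux, rank 2 — the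
weak Generalised Property R conjecture; Gompf–Scharlemann–Thompson 2010 Prop 9.2; KNOWN for `n ≤ 1` by
Gabai's Property R, tree fact `Literature.Topology.FourManifolds.isUnknot_of_isIntegralSurgery_zero`);
by Palais' disc theorem `U₁ ≅ 𝔻⁴`, likewise `U₂`, and `M = 𝔻⁴ ∪_{S³} 𝔻⁴` is a twisted sphere, hence
`S⁴` (`Literature.Topology.FourManifolds.cerf_twistedSphere_four`).  So this stub is DELEGATED on paper
to item 0377 (+ three classical facts); inside this line nobody should attack it.  At `k = 4` (`n = 3`)
the pieces carry more structure than 0377 uses: `X_w` is a union of three thin sectors of genus 3, and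
a genus-`≤ 3` BISECTION of a homology 4-ball with boundary `S³` is `B⁴` (Scharlemann 2008, Comment.
Math. Helv. 83; quoted in Islambouli–Naylor p. 4) — the route by which the first rung may close without
GPRC.  (Gabai 1987; Gompf–Scharlemann–Thompson 2010 (arXiv:1103.1601) Prop 9.2; Scharlemann 2008; Cerf 1968.) -/
theorem stub_sphereSplitStandard
    (M : Type) [TopologicalSpace M] [T2Space M] [SecondCountableTopology M] [ChartedSpace E4 M]
    [IsManifold (𝓡 4) ∞ M] (hM : M ≃ₕ 𝕊⁴) (n : ℕ) (h : SphereSplit M n) :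
    Nonempty (M ≃ₘ⟮𝓡 4, 𝓡 4⟯ 𝕊⁴) := by
  sorry

/-- **Stub 4 — THE DOUBLES CORNER = the shared residual `PlanarSteinDoubleStandard`: the double of a
contractible compact Stein domain with PLANAR contact boundary is `S⁴` (open; Andrews–Curtis strength;
size XL).**  Verbatim the statement of line seam-walk's `stub_planarSteinDouble` (TRIAGE-r1-2: "should be
filed once by the lead, not per line" — it is ONE item for both lines).  Data: `M` (Hausdorff, second
countable, `C^∞`) is the double `D(W) = W ∪_{id} W̄` (`Literature.Topology.FourManifolds.IsDouble`) of a
compact contractible Stein domain `(W, J)` whose contact boundary is planar.  Then `M ≅ S⁴`.  Content: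
`D(W) = ∂(W × I)`, `W` a 2-handlebody, so this is the planar slice of item stmt-SmoothPoincare4-3717
`PresentationSpheresStandard` and the `ψ = id` slice of the route's crux 4
`ContractibleTwistedDoubleStandard` (stmt-SmoothPoincare4-3546) — PROVED from the latter in §6
(`planarSteinDouble_of_crux4`, via the landed `double_standard_of_crux`): DELEGATE.  By TRIAGE-r1-3 (F1)
"planar" is no restriction up to stable Andrews–Curtis.  Reached by the lever with ZERO moves from every
honest double `(A, A)` — so the toy's observation that `D(X_A)` shows no certified sphere window at zero
moves is harmless to the line.  SPC4-implied. (Andrews–Curtis 1965; Gompf 1991.) -/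
theorem stub_planarSteinDouble
    (M : Type) [TopologicalSpace M] [T2Space M] [SecondCountableTopology M] [ChartedSpace E4 M]
    [IsManifold (𝓡 4) ∞ M]
    (W : Type) [TopologicalSpace W] [T2Space W] [SecondCountableTopology W]
    [ChartedSpace (EuclideanHalfSpace 4) W] [IsManifold (𝓡∂ 4) ∞ W] [CompactSpace W]
    [ContractibleSpace W] (J : SteinStructure W) (b : BoundaryData (𝓡∂ 4) W (𝓡 3))
    (hplanar : PlanarContactBoundary J) (hdouble : IsDouble b (𝓡 4) M) :
    Nonempty (M ≃ₘ⟮𝓡 4, 𝓡 4⟯ 𝕊⁴) := by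
  sorry

/-! ## §6  The composition (kernel-checked, no `sorry` of its own), and the delegation of Stub 4 -/

/-- **The four stubs prove the crux `ConvexBisection.PlanarBisectionRigidity` BY NAME.**  The dictionary
READS the planar bisection as a sphere grid word; the lever finds a grid-reachable state with a sphere
window or an honest double; the dictionary WRITES that state back as a split of `M` along a simply
connected seam into two contractible 2-handlebodies, resp. as a planar Stein double; the cap, resp. the
doubles corner, standardises `M`. -/
theorem PlanarBisectionRigidity_of : ConvexBisection.PlanarBisectionRigidity := by
  intro M _ _ _ _ _ hM hb
  obtain ⟨W₁, _, _, _, _, W₂, _, _, _, _, J₁, J₂, e₁, e₂, he₁, he₂, hcover, hseam₁, hseam₂, hξ, hpl⟩ :=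
    hb
  obtain ⟨n, A, B, hw, hwrite, hdouble⟩ :=
    stub_gridDictionary M hM W₁ W₂ J₁ J₂ e₁ e₂ he₁ he₂ hcover hseam₁ hseam₂ hξ hpl
  obtain ⟨n', A', B', hreach, htarget⟩ := stub_sphereWindow n A B hw
  rcases htarget with ⟨i, j, i', j', hwin⟩ | hAB
  · exact stub_sphereSplitStandard M hM n' (hwrite n' A' B' i j i' j' hreach hwin)
  · subst hAB
    obtain ⟨W, _, _, _, _, _, _, _, J, b, hplW, hD⟩ := hdouble n' A' hreach
    exact stub_planarSteinDouble M W J b hplW hD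

/-- **Stub 4 is implied by the route's rank-4 crux `ContractibleTwistedDoubleStandard`** (item
stmt-SmoothPoincare4-3546), even without planarity: a double `W ∪_id W` of a compact Stein domain is a
common-contact Stein bisection by two copies of `(W, J)` — the LANDED negative-side lemma
`Theorems/ContractibleTwistedDoubleStandard/Negative/DoubleBisection.lean`, `double_standard_of_crux`.
So the doubles corner is blocked on an EXISTING staffed item, not free-floating. [folklore] -/
theorem planarSteinDouble_of_crux4 (h4 : ConvexBisection.ContractibleTwistedDoubleStandard)
    (M : Type) [TopologicalSpace M] [T2Space M] [SecondCountableTopology M] [ChartedSpace E4 M]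
    [IsManifold (𝓡 4) ∞ M]
    (W : Type) [TopologicalSpace W] [T2Space W] [SecondCountableTopology W]
    [ChartedSpace (EuclideanHalfSpace 4) W] [IsManifold (𝓡∂ 4) ∞ W] [CompactSpace W]
    [ContractibleSpace W] (J : SteinStructure W) (b : BoundaryData (𝓡∂ 4) W (𝓡 3))
    (hplanar : PlanarContactBoundary J) (hdouble : IsDouble b (𝓡 4) M) :
    Nonempty (M ≃ₘ⟮𝓡 4, 𝓡 4⟯ 𝕊⁴) :=
  Theorems.ContractibleTwistedDoubleStandard.Negative.double_standard_of_crux h4 W J b M hdouble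

/-! ## §7  Sanity of the window calculus (kernel-checked examples) -/

/-- `k = 2` (annulus pages, `n = 1`): the round sphere `S⁴ = B⁴ ∪ B̄⁴` is the sphere grid word
`A = B = [c]`, `c` the core of the annulus; `(0,0) ≤ (0,1)` is a window of length `1`. [folklore] -/
example : IsWindow 1 0 0 0 1 :=
  ⟨Nat.zero_le _, Nat.zero_le _, le_rfl, Nat.zero_le _, Nat.zero_le _, by decide, by decide⟩

/-- … and its cross-section word is the single positive twist about the core: the cross-section is
`OB(annulus, T) = S³`, as it must be (`X_w` = one thin sector `= B⁴`, `X_{w′}` = the other). [folklore] -/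
example : crossSectionWord [⟨0, 0, []⟩] [⟨0, 0, []⟩] 0 0 0 1 = [PGen.round 0 0 false] := by
  decide

/-- … and its cross-section presentation IS the trivial presentation `⟨x₀ ∣ x₀⟩` (arc data of the
twist about the core: `u₀ = x₀`), so `(0,0) ≤ (0,1)` is a SPHERE WINDOW of the round sphere's word —
the `n = 1` instance of the lever, kernel-checked (the calculus has no junk at its base case). [folklore] -/
theorem crossSection_annulus :
    crossSection 1 [⟨0, 0, []⟩] [⟨0, 0, []⟩] 0 0 0 1 = BalancedPresentation.trivial 1 := by
  have hw : crossSectionWord [⟨0, 0, []⟩] [⟨0, 0, []⟩] 0 0 0 1 = [PGen.round 0 0 false] := by decide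
  funext i
  fin_cases i
  simp [crossSection, hw, evalWord, ArcData.mul, ArcData.one, ArcData.aut, PGen.data, PGen.blockWord,
    List.finRange, BalancedPresentation.trivial]

/-- The `n = 1` sphere window of `S⁴ = B⁴ ∪ B̄⁴` (annulus pages), kernel-checked. [folklore] -/
theorem sphereWindow_annulus : SphereWindow 1 [⟨0, 0, []⟩] [⟨0, 0, []⟩] 0 0 0 1 := by
  refine ⟨⟨Nat.zero_le _, Nat.zero_le _, le_rfl, Nat.zero_le _, Nat.zero_le _, by decide, by decide⟩,
    ?_⟩
  rw [crossSection_annulus]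
  exact BalancedPresentation.presentsTrivialGroup_trivial 1

/-- The round sphere's word `(1; [core], [core])` is a sphere grid word: lengths, range, equal frames,
and `⟨⟨x₀⟩⟩ = F₁`. [folklore] -/
theorem isSphereGridWord_annulus : IsSphereGridWord 1 [⟨0, 0, []⟩] [⟨0, 0, []⟩] := by
  refine ⟨Nat.one_pos, ?_, rfl, rfl, rfl, ?_⟩
  · intro c hc
    simp only [List.cons_append, List.mem_cons, List.not_mem_nil, or_false,
      List.nil_append, or_self] at hc
    subst hc
    exact ⟨le_rfl, Nat.one_pos, fun x hx => by simp at hx⟩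
  · have hc : PlanarCurve.cls 1 ⟨0, 0, []⟩ = FreeGroup.of 0 := by
      simp [PlanarCurve.cls, evalWord, ArcData.one, ArcData.aut, PGen.blockWord, List.finRange]
    rw [NormallyGenerates, eq_top_iff, ← FreeGroup.closure_range_of]
    refine (Subgroup.closure_le _).2 (fun x hx => Subgroup.subset_normalClosure ?_)
    obtain ⟨i, rfl⟩ := hx
    fin_cases i
    simp [hc]

/-- Hence the lever holds at the base case with ZERO moves (both of its targets, in fact: the word is
also an honest double). [folklore] -/
example : ∃ (n' : ℕ) (A' B' : List PlanarCurve), GridReachable (1, [⟨0, 0, []⟩], [⟨0, 0, []⟩]) (n', A', B') ∧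
    ((∃ i j i' j' : ℕ, SphereWindow n' A' B' i j i' j') ∨ A' = B') :=
  ⟨1, _, _, Relation.ReflTransGen.refl, Or.inl ⟨0, 0, 0, 1, sphereWindow_annulus⟩⟩

/-- Grid reachability is reflexive (zero moves). [folklore] -/
example (n : ℕ) (A B : List PlanarCurve) : GridReachable (n, A, B) (n, A, B) :=
  Relation.ReflTransGen.refl

end Summit.SmoothPoincare4.SmoothPoincare4.Cruxes.PlanarBisectionRigidity.HeegaardMorseThinMultisection

end
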